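import Mathlib
import Summits.NavierStokesRegularity.NavierStokesRegularity.Theorems.RootDecompLitSliceDarkBallSpreadsReversedVorticity
import HarnessLib

/-!
# Route RootDecompLitSlice — brick B4-APPLICATION «LOCAL SPREAD FROM FLATNESS», part 2/2
  (the ESS application), of the aside D₁ `DarkBallSpreads` (stmt-NavierStokesRegularity-29566, the
  registered stub `stub_darkBallSpreads` of crux D `NoDarkBall` stmt-NavierStokesRegularity-29563)

Continuation of `Theorems/RootDecompLitSliceDarkBallSpreadsReversedVorticity.lean` (part 1/2: the
reversed, translated, viscosity-normalised vorticity `U(s, y) = curl u(T − s/ν, y + x₁)`, its joint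
smoothness, continuity up to `s = 0` and the identity (4.2) `∂ₛU + ΔU = ν⁻¹((u·∇)ω − (ω·∇)u)`).

THIS FILE: the hypotheses (4.1) and (4.3) of the landed unique continuation through spatial
boundaries `Literature.Analysis.FluidPDE.ess_unique_continuation_holds` (Escauriaza–Seregin–Šverák
2003, Thm 4.1, `m = 3`) for `U` on `Q = (0, ν r²/4) × B(0, r/2)`, and the application:
* `rev_bounds` / `rev_timeDeriv_bound`: `U, ∇U, ∇²U, ∂ₛU` are bounded on `Q` by brick B1's bounds
  `‖Dⁿu‖ ≤ Kₙ` on the regular cylinder `Q_r(T, x₀)` (so the `W^{2,1}_2(Q)` integral is finite,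
  `rev_lintegral_lt_top`), and `‖∂ₛU + ΔU‖ ≤ ((K₀ + K₁)/ν)(‖U‖ + ‖∇U‖)` (`rev_ineq`);
* `rev_flat`: flatness `‖curl u(t, x)‖ ≤ C_k (T − t)^k` on `(T − τ, T) × B(x₁, δ)` (brick B3, census
  `vorticity_flat_of_tendsto_zero`, to be fed in by the FLAT adapter) gives
  `‖U(s, y)‖ ≤ C'_k (‖y‖ + √s)^k` on `Q` (three regimes: flat near `(0, 0)`; `‖y‖ ≥ δ`; `s ≥ ντ`);
* MAIN `localSpread_of_flatVorticity`: for `x₀ ∉ Σ_T` there is `ρ = r/2 > 0` such that for every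
  `x₁ ∉ Σ_T` with `dist x₁ x₀ < ρ`, if `curl w` vanishes near `x₁` (hence, by FLATNESS, the vorticity
  vanishes to infinite order at `(T, x₁)`), then `curl w` vanishes near `x₀` — ESS Thm 4.1 applied to
  `U` gives `U(0, ·) = curl w(· + x₁) = 0` on `B(0, r/2) ∋ x₀ − x₁`. This is VERBATIM the hypothesis
  `hLS` of `darkBallSpreads_of_localSpread` (ASSEMBLY file) once its flatness input is supplied.

HONEST FRAMING: an application of a LANDED literature theorem about a HYPOTHETICAL singular time;
closes no item by itself (the FLAT adapter and the final one-liners remain); decorative for the summit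
per D-0179; nothing here bears on NS regularity (rung 0).
Lands `--supports stmt-NavierStokesRegularity-29566 --as helper` (decomp-ns route-writer g16). [folklore]
-/

noncomputable section

open MeasureTheory Set Function Filter Topology Metric
open scoped ENNReal NNReal ContDiff Laplacian
open Literature.Analysis.FluidPDE

-- the summit and its single sub-problem share the name (CONVENTIONS §1), as in every Theorems file
set_option linter.dupNamespace false

namespace Summit.NavierStokesRegularity.NavierStokesRegularity.Theorems

namespace DarkBallLocalSpread

section Reversed

variable {ν T r : ℝ} {u : ℝ → EuclideanSpace ℝ (Fin 3) → EuclideanSpace ℝ (Fin 3)}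
  {p : ℝ → EuclideanSpace ℝ (Fin 3) → ℝ}
  {w : EuclideanSpace ℝ (Fin 3) → EuclideanSpace ℝ (Fin 3)} {x₀ x₁ : EuclideanSpace ℝ (Fin 3)}
  {U : ℝ → EuclideanSpace ℝ (Fin 3) → EuclideanSpace ℝ (Fin 3)}

/-- (4.1, space) On the reversed cylinder `‖U‖ ≤ ‖curl‖K₁`, `‖∇U‖ ≤ ‖curl‖K₂`, `‖∇²U‖ ≤ ‖curl‖K₃`
from B1's bounds `‖Dⁿu‖ ≤ Kₙ` on `Q_r(T, x₀)`. [folklore] -/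
theorem rev_bounds (hν : 0 < ν) (hrT : r ^ 2 < T) (hsol : IsClassicalNSSolutionOn (Ico 0 T) ν 0 u p)
    (hd : dist x₁ x₀ < r / 2) {K : ℕ → ℝ≥0}
    (hK : ∀ n, ∀ z ∈ parabolicCylinder r ((T : ℝ), x₀), ‖iteratedFDeriv ℝ n (u z.1) z.2‖ ≤ K n)
    (hU : ∀ s, 0 < s → ∀ y, U s y = curl (u (T - s / ν)) (y + x₁))
    {s : ℝ} (hs : s ∈ Ioo 0 (ν * (r / 2) ^ 2)) {y : EuclideanSpace ℝ (Fin 3)}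
    (hy : y ∈ ball (0 : EuclideanSpace ℝ (Fin 3)) (r / 2)) :
    ‖U s y‖ ≤ ‖curlCLM‖ * K 1 ∧ ‖fderiv ℝ (U s) y‖ ≤ ‖curlCLM‖ * K 2 ∧
      ‖iteratedFDeriv ℝ 2 (U s) y‖ ≤ ‖curlCLM‖ * K 3 := by
  obtain ⟨hmem, ht⟩ := rev_mem hν hrT hd hs hy
  have hv : ContDiff ℝ ∞ (u (T - s / ν)) := hsol.contDiff_velocity (Ioo_subset_Ico_self ht)
  have hslice := rev_slice_eq hU hs.1
  refine ⟨?_, ?_, ?_⟩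
  · rw [hU s hs.1 y]
    calc ‖curl (u (T - s / ν)) (y + x₁)‖ ≤ ‖curlCLM‖ * ‖fderiv ℝ (u (T - s / ν)) (y + x₁)‖ :=
          norm_curl_le _ _
      _ = ‖curlCLM‖ * ‖iteratedFDeriv ℝ 1 (u (T - s / ν)) (y + x₁)‖ := by
          rw [norm_iteratedFDeriv_one]
      _ ≤ ‖curlCLM‖ * K 1 := by gcongr; exact hK 1 (T - s / ν, y + x₁) hmem
  · rw [hslice, fderiv_comp_add_right]
    calc ‖fderiv ℝ (curl (u (T - s / ν))) (y + x₁)‖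
        = ‖iteratedFDeriv ℝ 1 (curl (u (T - s / ν))) (y + x₁)‖ := by rw [norm_iteratedFDeriv_one]
      _ ≤ ‖curlCLM‖ * ‖iteratedFDeriv ℝ (1 + 1) (u (T - s / ν)) (y + x₁)‖ :=
          norm_iteratedFDeriv_curl_le (hv.of_le (by norm_cast)) _
      _ ≤ ‖curlCLM‖ * K 2 := by gcongr; exact hK 2 (T - s / ν, y + x₁) hmem
  · rw [hslice, iteratedFDeriv_comp_add_right]
    calc ‖iteratedFDeriv ℝ 2 (curl (u (T - s / ν))) (y + x₁)‖
        ≤ ‖curlCLM‖ * ‖iteratedFDeriv ℝ (2 + 1) (u (T - s / ν)) (y + x₁)‖ :=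
          norm_iteratedFDeriv_curl_le (hv.of_le (by norm_cast)) _
      _ ≤ ‖curlCLM‖ * K 3 := by gcongr; exact hK 3 (T - s / ν, y + x₁) hmem

/-- (4.2 as an inequality) `‖∂ₛU + ΔU‖ ≤ ((K₀ + K₁)/ν)(‖U‖ + ‖∇U‖)` on the reversed cylinder.
[folklore] -/
theorem rev_ineq (hν : 0 < ν) (hT : 0 < T) (hrT : r ^ 2 < T)
    (hsol : IsClassicalNSSolutionOn (Ico 0 T) ν 0 u p) (hd : dist x₁ x₀ < r / 2) {K : ℕ → ℝ≥0}
    (hK : ∀ n, ∀ z ∈ parabolicCylinder r ((T : ℝ), x₀), ‖iteratedFDeriv ℝ n (u z.1) z.2‖ ≤ K n)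
    (hU : ∀ s, 0 < s → ∀ y, U s y = curl (u (T - s / ν)) (y + x₁))
    {s : ℝ} (hs : s ∈ Ioo 0 (ν * (r / 2) ^ 2)) {y : EuclideanSpace ℝ (Fin 3)}
    (hy : y ∈ ball (0 : EuclideanSpace ℝ (Fin 3)) (r / 2)) :
    ‖timeDeriv U s y + (Δ (U s)) y‖ ≤ ((K 0 + K 1) / ν) * (‖U s y‖ + ‖fderiv ℝ (U s) y‖) := by
  obtain ⟨hmem, ht⟩ := rev_mem hν hrT hd hs hy
  rw [rev_timeDeriv_add_laplacian hν hT hrT hsol hd hU hs hy]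
  have hslice := rev_slice_eq hU hs.1
  have hUy : U s y = curl (u (T - s / ν)) (y + x₁) := hU s hs.1 y
  have hDUy : fderiv ℝ (U s) y = fderiv ℝ (curl (u (T - s / ν))) (y + x₁) := by
    rw [hslice, fderiv_comp_add_right]
  have h0 : ‖u (T - s / ν) (y + x₁)‖ ≤ K 0 := by
    have := hK 0 (T - s / ν, y + x₁) hmem; rwa [norm_iteratedFDeriv_zero] at this
  have h1 : ‖fderiv ℝ (u (T - s / ν)) (y + x₁)‖ ≤ K 1 := by
    have := hK 1 (T - s / ν, y + x₁) hmem; rwa [norm_iteratedFDeriv_one] at this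
  have hA : ‖convect (curl (u (T - s / ν))) (u (T - s / ν)) (y + x₁)‖ ≤ K 1 * ‖U s y‖ := by
    rw [hUy]
    exact (ContinuousLinearMap.le_opNorm _ _).trans (by gcongr)
  have hB : ‖convect (u (T - s / ν)) (curl (u (T - s / ν))) (y + x₁)‖ ≤
      ‖fderiv ℝ (U s) y‖ * K 0 := by
    rw [hDUy]
    exact (ContinuousLinearMap.le_opNorm _ _).trans (by gcongr)
  have hK0 : (0 : ℝ) ≤ K 0 := (K 0).coe_nonneg
  have hK1 : (0 : ℝ) ≤ K 1 := (K 1).coe_nonneg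
  have hνinv : 0 ≤ 1 / ν := by positivity
  calc ‖(1 / ν) • (convect (u (T - s / ν)) (curl (u (T - s / ν))) (y + x₁) -
          convect (curl (u (T - s / ν))) (u (T - s / ν)) (y + x₁))‖
      ≤ (1 / ν) * (‖fderiv ℝ (U s) y‖ * K 0 + K 1 * ‖U s y‖) := by
        rw [norm_smul, Real.norm_of_nonneg hνinv]
        exact mul_le_mul_of_nonneg_left ((norm_sub_le _ _).trans (add_le_add hB hA)) hνinv
    _ ≤ ((K 0 + K 1) / ν) * (‖U s y‖ + ‖fderiv ℝ (U s) y‖) := by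
        have hX : ‖fderiv ℝ (U s) y‖ * K 0 + K 1 * ‖U s y‖ ≤
            (K 0 + K 1) * (‖U s y‖ + ‖fderiv ℝ (U s) y‖) := by
          nlinarith [norm_nonneg (U s y), norm_nonneg (fderiv ℝ (U s) y),
            mul_nonneg hK0 (norm_nonneg (U s y)), mul_nonneg hK1 (norm_nonneg (fderiv ℝ (U s) y))]
        calc (1 / ν) * (‖fderiv ℝ (U s) y‖ * K 0 + K 1 * ‖U s y‖)
            ≤ (1 / ν) * ((K 0 + K 1) * (‖U s y‖ + ‖fderiv ℝ (U s) y‖)) :=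
              mul_le_mul_of_nonneg_left hX hνinv
          _ = ((K 0 + K 1) / ν) * (‖U s y‖ + ‖fderiv ℝ (U s) y‖) := by ring

/-- (4.1, time) `‖∂ₛU‖` is bounded on the reversed cylinder. [folklore] -/
theorem rev_timeDeriv_bound (hν : 0 < ν) (hT : 0 < T) (hrT : r ^ 2 < T)
    (hsol : IsClassicalNSSolutionOn (Ico 0 T) ν 0 u p) (hd : dist x₁ x₀ < r / 2) {K : ℕ → ℝ≥0}
    (hK : ∀ n, ∀ z ∈ parabolicCylinder r ((T : ℝ), x₀), ‖iteratedFDeriv ℝ n (u z.1) z.2‖ ≤ K n)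
    (hU : ∀ s, 0 < s → ∀ y, U s y = curl (u (T - s / ν)) (y + x₁))
    {s : ℝ} (hs : s ∈ Ioo 0 (ν * (r / 2) ^ 2)) {y : EuclideanSpace ℝ (Fin 3)}
    (hy : y ∈ ball (0 : EuclideanSpace ℝ (Fin 3)) (r / 2)) :
    ‖timeDeriv U s y‖ ≤ ((K 0 + K 1) / ν) * (‖curlCLM‖ * K 1 + ‖curlCLM‖ * K 2) +
      3 * (‖curlCLM‖ * K 3) := by
  obtain ⟨hb0, hb1, hb2⟩ := rev_bounds hν hrT hsol hd hK hU hs hy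
  have hineq := rev_ineq hν hT hrT hsol hd hK hU hs hy
  obtain ⟨hmem, ht⟩ := rev_mem hν hrT hd hs hy
  have hv : ContDiff ℝ ∞ (u (T - s / ν)) := hsol.contDiff_velocity (Ioo_subset_Ico_self ht)
  have hc : ContDiff ℝ ∞ (curl (u (T - s / ν))) := by
    rw [curl_eq_curlCLM_comp]; exact curlCLM.contDiff.comp (contDiff_infty_iff_fderiv.1 hv).2
  have hcurl2 : ContDiff ℝ 2 (U s) := by
    rw [rev_slice_eq hU hs.1]
    exact (hc.of_le (by norm_cast)).comp (contDiff_id.add contDiff_const)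
  have hL : ‖(Δ (U s)) y‖ ≤ 3 * (‖curlCLM‖ * K 3) :=
    (norm_laplacian_le_three_mul_norm_iteratedFDeriv_two hcurl2 y).trans (by gcongr)
  have hc : 0 ≤ ((K 0 : ℝ) + K 1) / ν := by positivity
  have e1 : ‖timeDeriv U s y‖ ≤ ‖timeDeriv U s y + (Δ (U s)) y‖ + ‖(Δ (U s)) y‖ := by
    have := norm_sub_le (timeDeriv U s y + (Δ (U s)) y) ((Δ (U s)) y)
    rwa [add_sub_cancel_right] at this
  have e2 := add_le_add hineq hL
  have e3 : ((K 0 + K 1) / ν) * (‖U s y‖ + ‖fderiv ℝ (U s) y‖) + 3 * (‖curlCLM‖ * K 3) ≤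
      ((K 0 + K 1) / ν) * (‖curlCLM‖ * K 1 + ‖curlCLM‖ * K 2) + 3 * (‖curlCLM‖ * K 3) := by
    gcongr
  exact (e1.trans e2).trans e3

/-- (4.1) The `W^{2,1}_2` integrand of `U` over the bounded reversed cylinder is finite. [folklore] -/
theorem rev_lintegral_lt_top (hν : 0 < ν) (hT : 0 < T) (hrT : r ^ 2 < T)
    (hsol : IsClassicalNSSolutionOn (Ico 0 T) ν 0 u p) (hd : dist x₁ x₀ < r / 2) {K : ℕ → ℝ≥0}
    (hK : ∀ n, ∀ z ∈ parabolicCylinder r ((T : ℝ), x₀), ‖iteratedFDeriv ℝ n (u z.1) z.2‖ ≤ K n)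
    (hU : ∀ s, 0 < s → ∀ y, U s y = curl (u (T - s / ν)) (y + x₁)) :
    (∫⁻ z in Ioo 0 (ν * (r / 2) ^ 2) ×ˢ ball (0 : EuclideanSpace ℝ (Fin 3)) (r / 2),
      (‖U z.1 z.2‖ₑ ^ 2 + ‖fderiv ℝ (U z.1) z.2‖ₑ ^ 2 + ‖iteratedFDeriv ℝ 2 (U z.1) z.2‖ₑ ^ 2 +
        ‖timeDeriv U z.1 z.2‖ₑ ^ 2)) < (⊤ : ℝ≥0∞) := by
  set Q := Ioo 0 (ν * (r / 2) ^ 2) ×ˢ ball (0 : EuclideanSpace ℝ (Fin 3)) (r / 2) with hQ_def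
  have hQ : MeasurableSet Q := measurableSet_Ioo.prod measurableSet_ball
  have hIoo : volume (Ioo (0 : ℝ) (ν * (r / 2) ^ 2)) < (⊤ : ℝ≥0∞) := by
    rw [Real.volume_Ioo]; exact ENNReal.ofReal_lt_top
  have hμQ : volume Q < (⊤ : ℝ≥0∞) := by
    rw [hQ_def, Measure.volume_eq_prod, Measure.prod_prod]
    exact ENNReal.mul_lt_top hIoo measure_ball_lt_top
  -- one real bound for all four terms
  set B : ℝ := ‖curlCLM‖ * K 1 + ‖curlCLM‖ * K 2 + ‖curlCLM‖ * K 3 +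
    (((K 0 + K 1) / ν) * (‖curlCLM‖ * K 1 + ‖curlCLM‖ * K 2) + 3 * (‖curlCLM‖ * K 3)) with hB_def
  have hnn : ∀ n, 0 ≤ ‖curlCLM‖ * (K n : ℝ) := fun n => by positivity
  have hnt : 0 ≤ ((K 0 : ℝ) + K 1) / ν * (‖curlCLM‖ * K 1 + ‖curlCLM‖ * K 2) + 3 * (‖curlCLM‖ * K 3) := by
    positivity
  have hbound : ∀ z ∈ Q, (‖U z.1 z.2‖ₑ ^ 2 + ‖fderiv ℝ (U z.1) z.2‖ₑ ^ 2 +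
      ‖iteratedFDeriv ℝ 2 (U z.1) z.2‖ₑ ^ 2 + ‖timeDeriv U z.1 z.2‖ₑ ^ 2) ≤
      4 * ENNReal.ofReal B ^ 2 := by
    rintro ⟨s, y⟩ ⟨hs, hy⟩
    obtain ⟨hb0, hb1, hb2⟩ := rev_bounds hν hrT hsol hd hK hU hs hy
    have hbt := rev_timeDeriv_bound hν hT hrT hsol hd hK hU hs hy
    have e0 := enorm_sq_le_of_norm_le (hb0.trans (show ‖curlCLM‖ * (K 1 : ℝ) ≤ B by
      rw [hB_def]; linarith [hnn 2, hnn 3]))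
    have e1 := enorm_sq_le_of_norm_le (hb1.trans (show ‖curlCLM‖ * (K 2 : ℝ) ≤ B by
      rw [hB_def]; linarith [hnn 1, hnn 3]))
    have e2 := enorm_sq_le_of_norm_le (hb2.trans (show ‖curlCLM‖ * (K 3 : ℝ) ≤ B by
      rw [hB_def]; linarith [hnn 1, hnn 2]))
    have et := enorm_sq_le_of_norm_le (hbt.trans (show ((K 0 : ℝ) + K 1) / ν *
      (‖curlCLM‖ * K 1 + ‖curlCLM‖ * K 2) + 3 * (‖curlCLM‖ * K 3) ≤ B by
      rw [hB_def]; linarith [hnn 1, hnn 2, hnn 3]))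
    calc _ ≤ ENNReal.ofReal B ^ 2 + ENNReal.ofReal B ^ 2 + ENNReal.ofReal B ^ 2 + ENNReal.ofReal B ^ 2 :=
          add_le_add (add_le_add (add_le_add e0 e1) e2) et
      _ = 4 * ENNReal.ofReal B ^ 2 := by ring
  refine lt_of_le_of_lt (setLIntegral_mono' hQ hbound) ?_
  rw [setLIntegral_const]
  have h4 : (4 : ℝ≥0∞) < ⊤ := by norm_num
  have hc : 4 * ENNReal.ofReal B ^ 2 < (⊤ : ℝ≥0∞) :=
    ENNReal.mul_lt_top h4 (ENNReal.pow_lt_top ENNReal.ofReal_lt_top)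
  exact ENNReal.mul_lt_top hc hμQ

/-- (4.3) Flatness at `(T, x₁)` and boundedness of the vorticity on `Q_r(T, x₀)` give
`‖U(s, y)‖ ≤ C'_k (‖y‖ + √s)^k` on the reversed cylinder. [folklore] -/
theorem rev_flat (hν : 0 < ν) (hrT : r ^ 2 < T) (hd : dist x₁ x₀ < r / 2) {Kω : ℝ}
    (hKω : ∀ z ∈ parabolicCylinder r ((T : ℝ), x₀), ‖curl (u z.1) z.2‖ ≤ Kω)
    {δ τ : ℝ} (hδ : 0 < δ) (hτ : 0 < τ)
    (hC : ∀ k : ℕ, ∃ C : ℝ, ∀ t ∈ Ioo (T - τ) T, ∀ x ∈ ball x₁ δ, ‖curl (u t) x‖ ≤ C * (T - t) ^ k)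
    (hU : ∀ s, 0 < s → ∀ y, U s y = curl (u (T - s / ν)) (y + x₁)) :
    ∀ k : ℕ, ∃ C : ℝ, ∀ s ∈ Ioo 0 (ν * (r / 2) ^ 2), ∀ y ∈ ball (0 : EuclideanSpace ℝ (Fin 3)) (r / 2),
      ‖U s y‖ ≤ C * (‖y‖ + Real.sqrt s) ^ k := by
  intro k
  obtain ⟨C, hC⟩ := hC k
  set C' : ℝ := max C 0
  set K' : ℝ := max Kω 0
  set S₀ : ℝ := ν * (r / 2) ^ 2
  have hC' : 0 ≤ C' := le_max_right _ _
  have hK' : 0 ≤ K' := le_max_right _ _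
  have hντ : 0 < Real.sqrt (ν * τ) := Real.sqrt_pos.2 (mul_pos hν hτ)
  set CA : ℝ := C' * Real.sqrt S₀ ^ k / ν ^ k
  set CB : ℝ := K' / δ ^ k
  set CC : ℝ := K' / Real.sqrt (ν * τ) ^ k
  have hCA : 0 ≤ CA := by positivity
  have hCB : 0 ≤ CB := by positivity
  have hCC : 0 ≤ CC := by positivity
  refine ⟨CA + CB + CC, fun s hs y hy => ?_⟩
  obtain ⟨hmem, ht⟩ := rev_mem hν hrT hd hs hy
  rw [hU s hs.1 y]
  set q : ℝ := ‖y‖ + Real.sqrt s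
  have hsq0 : 0 ≤ Real.sqrt s := Real.sqrt_nonneg _
  have hq : 0 ≤ q := by positivity
  have hyq : ‖y‖ ≤ q := le_add_of_nonneg_right hsq0
  have hsq : Real.sqrt s ≤ q := le_add_of_nonneg_left (norm_nonneg _)
  have hqk : 0 ≤ q ^ k := pow_nonneg hq k
  have hωb : ‖curl (u (T - s / ν)) (y + x₁)‖ ≤ K' :=
    (hKω (T - s / ν, y + x₁) hmem).trans (le_max_left _ _)
  have htot : ∀ {a : ℝ}, 0 ≤ a → (a = CA ∨ a = CB ∨ a = CC) → a * q ^ k ≤ (CA + CB + CC) * q ^ k := by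
    intro a ha h
    apply mul_le_mul_of_nonneg_right _ hqk
    rcases h with rfl | rfl | rfl <;> linarith
  by_cases hyδ : ‖y‖ < δ
  · by_cases hst : s / ν < τ
    · -- regime A: flatness
      have htI : T - s / ν ∈ Ioo (T - τ) T := ⟨by linarith, ht.2⟩
      have hxI : y + x₁ ∈ ball x₁ δ := by rwa [mem_ball, dist_eq_norm, add_sub_cancel_right]
      have h1 : ‖curl (u (T - s / ν)) (y + x₁)‖ ≤ C' * (s / ν) ^ k := by
        refine (hC _ htI _ hxI).trans ?_
        rw [show T - (T - s / ν) = s / ν by ring]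
        exact mul_le_mul_of_nonneg_right (le_max_left _ _) (pow_nonneg (div_pos hs.1 hν).le k)
      have h2 : (s / ν) ^ k = Real.sqrt s ^ k * Real.sqrt s ^ k / ν ^ k := by
        rw [div_pow, ← mul_pow, Real.mul_self_sqrt hs.1.le]
      have h3 : Real.sqrt s ^ k ≤ Real.sqrt S₀ ^ k :=
        pow_le_pow_left₀ hsq0 (Real.sqrt_le_sqrt hs.2.le) k
      have h4 : Real.sqrt s ^ k ≤ q ^ k := pow_le_pow_left₀ hsq0 hsq k
      have h5 : C' * (s / ν) ^ k ≤ CA * q ^ k := by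
        rw [h2]
        have h6 : Real.sqrt s ^ k * Real.sqrt s ^ k ≤ Real.sqrt S₀ ^ k * q ^ k :=
          mul_le_mul h3 h4 (pow_nonneg hsq0 k) (pow_nonneg (Real.sqrt_nonneg _) k)
        calc C' * (Real.sqrt s ^ k * Real.sqrt s ^ k / ν ^ k)
            ≤ C' * (Real.sqrt S₀ ^ k * q ^ k / ν ^ k) := by gcongr
          _ = CA * q ^ k := by rw [show CA = C' * Real.sqrt S₀ ^ k / ν ^ k from rfl]; ring
      exact (h1.trans h5).trans (htot hCA (Or.inl rfl))
    · -- regime C: `s ≥ ντ`, bounded vorticity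
      have hst' : τ ≤ s / ν := not_lt.1 hst
      have hνs : ν * τ ≤ s := by
        have := (le_div_iff₀ hν).1 hst'
        linarith
      have h1 : Real.sqrt (ν * τ) ≤ q := (Real.sqrt_le_sqrt hνs).trans hsq
      have h2 : 1 ≤ q ^ k / Real.sqrt (ν * τ) ^ k := by
        rw [one_le_div (pow_pos hντ k)]; exact pow_le_pow_left₀ hντ.le h1 k
      have h3 : K' ≤ CC * q ^ k := by
        calc K' = K' * 1 := (mul_one _).symm
          _ ≤ K' * (q ^ k / Real.sqrt (ν * τ) ^ k) := mul_le_mul_of_nonneg_left h2 hK'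
          _ = CC * q ^ k := by rw [show CC = K' / Real.sqrt (ν * τ) ^ k from rfl]; ring
      exact (hωb.trans h3).trans (htot hCC (Or.inr (Or.inr rfl)))
  · -- regime B: `‖y‖ ≥ δ`, bounded vorticity
    have hδy : δ ≤ ‖y‖ := not_lt.1 hyδ
    have h1 : 1 ≤ ‖y‖ ^ k / δ ^ k := by
      rw [one_le_div (pow_pos hδ k)]; exact pow_le_pow_left₀ hδ.le hδy k
    have h2 : K' ≤ CB * q ^ k := by
      calc K' = K' * 1 := (mul_one _).symm
        _ ≤ K' * (‖y‖ ^ k / δ ^ k) := mul_le_mul_of_nonneg_left h1 hK'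
        _ = CB * ‖y‖ ^ k := by rw [show CB = K' / δ ^ k from rfl]; ring
        _ ≤ CB * q ^ k := mul_le_mul_of_nonneg_left (pow_le_pow_left₀ (norm_nonneg _) hyq k) hCB
    exact (hωb.trans h2).trans (htot hCB (Or.inr (Or.inl rfl)))

end Reversed

end DarkBallLocalSpread

open DarkBallLocalSpread in
/-- **LOCAL SPREAD FROM FLATNESS** (brick B4-APPLICATION of the aside D₁ `DarkBallSpreads`; ESS 2003
Thm 4.1 applied to the reversed vorticity). `ν, T > 0`, `(u, p)` classical on `[0, T)`, Leray–Hopf on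
`[0, T]` from a rapidly decaying datum, `w` the pointwise limit of `u t` (`t → T⁻`) off the
backward-singular terminal slice `Σ_T`. FLATNESS HYPOTHESIS `hflat` (brick B3 + the FLAT adapter):
wherever `curl w` vanishes near a regular `x₁`, the vorticity vanishes to infinite order in
`T − t` on a space–time neighbourhood of `(T, x₁)`. CONCLUSION: the LOCAL SPREAD property — every
regular `x₀` has a radius `ρ > 0` such that `curl w ≡ 0` near any regular `x₁` within `ρ` of `x₀`
forces `curl w ≡ 0` near `x₀` — verbatim the hypothesis `hLS` of `darkBallSpreads_of_localSpread`
(writer's ASSEMBLY modulo local spread). Decorative for the summit (D-0179). [folklore] -/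
theorem localSpread_of_flatVorticity {ν T : ℝ} (hν : 0 < ν) (hT : 0 < T)
    {u : ℝ → EuclideanSpace ℝ (Fin 3) → EuclideanSpace ℝ (Fin 3)}
    {p : ℝ → EuclideanSpace ℝ (Fin 3) → ℝ}
    (hsol : IsClassicalNSSolutionOn (Ico 0 T) ν 0 u p) (hLH : IsLerayHopfOn T ν 0 (u 0) u)
    (hdec : HasRapidSpatialDecay (u 0))
    {w : EuclideanSpace ℝ (Fin 3) → EuclideanSpace ℝ (Fin 3)}
    (hw : ∀ y ∈ {x : EuclideanSpace ℝ (Fin 3) | IsBackwardSingularPoint u ((T : ℝ), x)}ᶜ,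
      Tendsto (fun t => u t y) (𝓝[<] T) (𝓝 (w y)))
    (hflat : ∀ x₁ ∈ {x : EuclideanSpace ℝ (Fin 3) | IsBackwardSingularPoint u ((T : ℝ), x)}ᶜ,
      (∀ᶠ y in 𝓝 x₁, curl w y = 0) → ∃ δ > 0, ∃ τ > 0, ∀ k : ℕ, ∃ C : ℝ,
        ∀ t ∈ Ioo (T - τ) T, ∀ x ∈ ball x₁ δ, ‖curl (u t) x‖ ≤ C * (T - t) ^ k) :
    ∀ x₀ ∈ {x : EuclideanSpace ℝ (Fin 3) | IsBackwardSingularPoint u ((T : ℝ), x)}ᶜ, ∃ ρ > 0,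
      ∀ x₁ ∈ {x : EuclideanSpace ℝ (Fin 3) | IsBackwardSingularPoint u ((T : ℝ), x)}ᶜ,
        dist x₁ x₀ < ρ → (∀ᶠ y in 𝓝 x₁, curl w y = 0) → ∀ᶠ y in 𝓝 x₀, curl w y = 0 := by
  intro x₀ hx₀
  obtain ⟨r, hr, hrT, hB⟩ := regularPoint_iteratedFDeriv_bounds hν hT hsol hLH hdec hx₀
  choose K C α hα hHol hK using hB
  refine ⟨r / 2, by positivity, fun x₁ _ hd hflat₁ => ?_⟩
  obtain ⟨δ, hδ, τ, hτ, hC⟩ := hflat x₁ ‹_› hflat₁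
  -- the regular ball `B(x₀, r) ⊆ Σ_Tᶜ`
  have hK0 : ∀ z ∈ parabolicCylinder r ((T : ℝ), x₀), ‖u z.1 z.2‖ ≤ K 0 := fun z hz => by
    have := hK 0 z hz; rwa [norm_iteratedFDeriv_zero] at this
  have hreg : ∀ x ∈ ball x₀ r, ¬ IsBackwardSingularPoint u ((T : ℝ), x) := fun x hx =>
    not_isBackwardSingularPoint_of_mem_ball hK0 hx
  -- the derivative tower on `Q_r(T, x₀)` (brick B1′ part 1): `w` smooth, `D(u t) → Dw` uniformly
  have hab : T - r ^ 2 < T := by nlinarith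
  have hS : ∀ s ∈ Ioo (T - r ^ 2) T, ∀ y ∈ ball x₀ r, ContDiffAt ℝ ∞ (u s) y := fun s hs y _ =>
    (hsol.contDiff_velocity ⟨by linarith [hs.1], hs.2⟩).contDiffAt
  have hH : ∀ n : ℕ, ∃ C α : ℝ≥0, 0 < α ∧ HolderOnWith C α
      (fun z : ℝ × EuclideanSpace ℝ (Fin 3) => iteratedFDeriv ℝ n (u z.1) z.2)
      (Ioo (T - r ^ 2) T ×ˢ ball x₀ r) := fun n => ⟨C n, α n, hα n, hHol n⟩
  have hwb : ∀ y ∈ ball x₀ r, Tendsto (fun s => u s y) (𝓝[<] T) (𝓝 (w y)) := fun y hy =>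
    hw y (hreg y hy)
  have hW : ContDiffOn ℝ ∞ w (ball x₀ r) :=
    contDiffOn_of_tendsto_of_holderOnWith_iteratedFDeriv hab isOpen_ball hS hH hwb
  have hconv : TendstoUniformlyOn (fun s => fderiv ℝ (u s)) (fderiv ℝ w) (𝓝[<] T) (ball x₀ r) :=
    tendstoUniformlyOn_fderiv_of_tendsto_of_holderOnWith_iteratedFDeriv hab isOpen_ball hS hH hwb
  have hWc : ContinuousOn (fun x => curl w x) (ball x₀ r) := by
    have h1 : ContinuousOn (fderiv ℝ w) (ball x₀ r) :=
      hW.continuousOn_fderiv_of_isOpen isOpen_ball (by norm_cast)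
    exact curlCLM.continuous.comp_continuousOn h1
  -- the reversed vorticity
  obtain ⟨U, hU_def⟩ : ∃ U : ℝ → EuclideanSpace ℝ (Fin 3) → EuclideanSpace ℝ (Fin 3),
      U = fun s y => if 0 < s then curl (u (T - s / ν)) (y + x₁) else curl w (y + x₁) := ⟨_, rfl⟩
  have hU : ∀ s, 0 < s → ∀ y, U s y = curl (u (T - s / ν)) (y + x₁) := fun s hs y => by
    rw [hU_def]; exact if_pos hs
  have hU0 : ∀ y, U 0 y = curl w (y + x₁) := fun y => by
    rw [hU_def]; exact if_neg (lt_irrefl 0)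
  have hsm := hsol.smooth_velocity
  have hR : 0 < r / 2 := by positivity
  have hS₀ : 0 < ν * (r / 2) ^ 2 := by positivity
  have hKω : ∀ z ∈ parabolicCylinder r ((T : ℝ), x₀), ‖curl (u z.1) z.2‖ ≤ ‖curlCLM‖ * K 1 :=
    fun z hz => by
    calc ‖curl (u z.1) z.2‖ ≤ ‖curlCLM‖ * ‖fderiv ℝ (u z.1) z.2‖ := norm_curl_le _ _
      _ = ‖curlCLM‖ * ‖iteratedFDeriv ℝ 1 (u z.1) z.2‖ := by rw [norm_iteratedFDeriv_one]
      _ ≤ ‖curlCLM‖ * K 1 := by gcongr; exact hK 1 z hz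
  -- ESS 2003, Theorem 4.1 (unique continuation through the spatial boundary `s = 0`)
  have key : ∀ y ∈ ball (0 : EuclideanSpace ℝ (Fin 3)) (r / 2), U 0 y = 0 :=
    ess_unique_continuation_holds 3 (r / 2) (ν * (r / 2) ^ 2) hR hS₀ U ((K 0 + K 1) / ν)
      ((rev_contDiffOn hν hrT hsm hd hU).of_le (by norm_cast))
      (rev_continuousOn hν hrT hsm hd hWc hconv hU hU0)
      (rev_lintegral_lt_top hν hT hrT hsol hd hK hU)
      (fun s hs y hy => rev_ineq hν hT hrT hsol hd hK hU hs hy)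
      (rev_flat hν hrT hd hKω hδ hτ hC hU)
  -- `curl w = 0` on `B(x₁, r/2) ∋ x₀`
  have hx₀ball : x₀ ∈ ball x₁ (r / 2) := by rw [mem_ball, dist_comm]; exact hd
  refine mem_of_superset (isOpen_ball.mem_nhds hx₀ball) fun x hx => ?_
  have h := key (x - x₁) (by rwa [mem_ball_zero_iff, ← dist_eq_norm])
  rw [hU0, sub_add_cancel] at h
  exact h

end Summit.NavierStokesRegularity.NavierStokesRegularity.Theorems
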